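import Summits.QuantumFields.GaugeBoot.DiagonalRPTorusTwoOrbit
import Summits.QuantumFields.GaugeBoot.DiagonalRPTorusTwoDegenerate
import HarnessLib

/-!
# Diagonal-plane reflection positivity fails on the TWO-dimensional even torus as well
(gauge-boot, task L3(δ))

HONEST FRAMING (cell `pub-gaugeboot`, page 1 of every file): the venture produces certified bounds
on lattice expectations at stated coupling, gauge group, dimension and torus size; NOT a mass gap,
NOT a continuum limit, NOT a string tension; NOT Yang–Mills-summit-bearing (barriers
`FixedCouplingUltralocality`, `PerturbativeInvisibility`). This module is a small NEGATIVE result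
about which positivity constraints a TORUS certificate may use; it discharges nothing else.

## Content

`DiagonalRPTorusNegative.lean` shows that the closed-half-space diagonal reflection positivity
`DiagonalReflectionPositive ρ β i j` (the shape of a diagonal `R₂`-type certificate block) fails on
the periodic torus `(ℤ/L)^d` for `d ≥ 3`, at every `β`, by a GEOMETRIC obstruction (a link inside
the back layer `y_i - y_j ≡ L/2` that the swap moves; pub-gaugeboot LOOP-SDP.md §3.4(i)), and
leaves `d = 2` open: for `L ≥ 4` no link of the two-dimensional torus lies inside that layer, the
two closed halves have no link in common, and at `β = 0` the statement is (trivially) TRUE. This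
file settles `d = 2` (all declarations in the namespace `Summit.QuantumFields.GaugeBoot.DiagRPTwo`;
groundwork in `DiagonalRPTorusTwoGeometry.lean`, `…TwoHaar.lean`, `…TwoOrbit.lean`; the
degenerate cases `L = 2` and `β = 0` in `DiagonalRPTorusTwoDegenerate.lean`):

* **`exists_diagonalHalfObservable_wilsonExpectation_neg_two`** — on `(ℤ/L)²`, `L` even, `L ≥ 4`,
  for every `β ≠ 0`, every compact metrisable group `G` (`CompactSpace`, `T2Space`,
  `SecondCountableTopology`) and every continuous `ρ : G →* Matrix (Fin N) (Fin N) ℂ` whose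
  character is not constant (`∃ g, Re tr ρ(g) ≠ N`), there is a bounded measurable observable `F`
  of the closed diagonal half with `⟨(ΘF)‾ F⟩_{Λ,β} < 0` (real and negative);
* **`not_diagonalReflectionPositive_two`** — hence `¬ DiagonalReflectionPositive ρ β i j`
  (`d = 2`, `L ≥ 4` even, `β ≠ 0`);
* (`DiagonalRPTorusTwoDegenerate.lean`: `not_diagonalReflectionPositive_two_two` — the `2 × 2`
  torus, where the closed half is everything and the geometric witness of `d ≥ 3` applies: failure
  at EVERY `β`; and `diagonalReflectionPositive_zero` — at `β = 0`, `L ≥ 4`, diagonal RP HOLDS, the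
  two closed halves having no link in common; so in `d = 2` the failure is genuinely dynamical.)

So the folklore sentence "square periodic tori are not swap reflection positive" (cf. the
docstring of `Literature.MathematicalPhysics.QuantumFieldTheory.TiltedTorusSwapRP`) is a theorem in
every dimension `d ≥ 2`; in `d = 2`, `L ≥ 4` the obstruction is DYNAMICAL (it disappears at
`β = 0`). The positivity of diagonal Gram blocks of Wilson lines supported strictly inside the half
(`0 ≤ k ≤ m < L/2`, LOOP-SDP.md §3.4(ii)) is a different question and is not touched here.

## Mechanism (`L ≥ 4`)

Write `k = y_i - y_j`, `c = L/2`, `θ` the swap, `Θ U = U ∘ θ`. In `d = 2` every plaquette is based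
at a site `y` and its holonomy is `C_y D_y⁻¹` with the two transports `C_y = U(y,i) U(y+e_i,j)`,
`D_y = U(y,j) U(y+e_j,i)` from `y` to `y + e_i + e_j` (`cT`, `dT`; `plaqRe_eq_rr`); one has
`C_y(ΘU) = D_{θy}(U)`, `D_y(ΘU) = C_{θy}(U)` and `Re tr ρ(U_y(ΘU)) = Re tr ρ(U_{θy}(U))`
(`rr_configDiagSwap`). Plaquettes with `0 < k < c` use only links of the closed half `0 ≤ k ≤ c`
(`inHalf_blk`), those with `c < k < L` only links of the opposite closed half, and `θ` exchanges the
two families (`sum_Sp_swap`); so for a half observable `F̃` the observable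
`F = F̃ · exp(-β Σ_{0<k<c} Re tr ρ(U_y))` is again a bounded half observable and
`(ΘF)‾ F e^{-βS} = e^{-βN#P} (ΘF̃)‾ F̃ · e^{β Σ_{k=0} Re tr ρ(U_y)} · e^{β Σ_{k=c} Re tr ρ(U_y)}`:
the
interior couplings are gone. The mirror factor (`k = 0`) lives on links disjoint from everything
else (`disjoint_blk`) and integrates to a positive constant (independence of disjoint link blocks
under product Haar measure, `LatticeRP.integral_mul_eq_of_dependsOn`). In the back layer `k = c`
the swap has NO fixed site (`θy = y` forces `k = 0`), so its plaquettes come in orbits `{y, θy}`,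
`y ≠ θy`, and the plaquette at `y` couples the half-side transport `D_y` to `C_y = D_{θy} ∘ Θ` — the
pairing of the half with its mirror image is TWISTED by `θ`. Taking
`F̃(U) = φ₀(D_{y₁}(U)) + s φ₀(D_{y₂}(U))` for the orbit `y₁ = (L/2) e_i`, `y₂ = θ y₁ = (L/2) e_j`,
with `φ₀ = φ - ∫φ` and `s = ∓1`, independence and the link-by-link change of variables
`U_a ↦ U_a U_b` (`Literature.MathematicalPhysics.QuantumLattice.measurePreserving_update_mul_pi`;
`integral_transport_pair`, `integral_plaquette_four`) reduce `⟨(ΘF)‾F⟩` to a positive multiple of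
`s c₀ (Q₁ + Q₂)` (`integral_orbit`), `c₀ = ∫ κ > 0`, `κ = exp(β Re tr ρ)`,
`Q_k = ∫∫ κ(g h⁻¹) φ₀(g) φ₀(h) dg dh`; and for `φ` a Urysohn bump at `1 ∈ G` supported where
`κ(g h⁻¹)` is within `δ = |κ(1) - c₀|/2` of `κ(1)` (`exists_bump`), `Q_k - (κ(1) - c₀)(∫φ)²` is at
most `δ (∫φ)²` in absolute value, while `κ(1) - c₀` has the sign of `β` and absolute value `2δ > 0`
as soon as the character of `ρ` is not constant. Hence `s Q_k < 0` for `s = -sign β` (`sign_Q`).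
(At the level of kernels: the reduced kernel on `G × G` is `(K ⊗ K) ∘ swap`, whose spectrum
contains `-λ_r λ_s`.)

## What is NOT claimed

* `β = 0`, `L ≥ 4`, `d = 2`: there the two closed halves are independent and swap-RP holds
  (`diagonalReflectionPositive_zero` in `DiagonalRPTorusTwoDegenerate.lean`).
* Observables supported strictly inside the half (`0 ≤ k ≤ m < c`, LOOP-SDP.md §3.4(ii)): not
  covered, as in `d ≥ 3`.
* Nothing about `ℤ²`, free boxes (there diagonal RP holds, `DiagonalRPFreeBox.lean`) or the tilted
  (Fröhlich–Israel–Lieb–Simon) torus (`TiltedTorusSwapRP.lean`, where it holds).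

References: K. Osterwalder, E. Seiler, Ann. Phys. 110 (1978) 440, §2; J. Fröhlich, R. Israel,
E. H. Lieb, B. Simon, J. Stat. Phys. 22 (1980) 297, §3; V. Kazakov, Z. Zheng, arXiv:2203.11360 §3.1.
The negative itself is elementary and, as far as the cell's searches go, not in print as a theorem.
Printed precedent (nearest-neighbour spin systems, a remark without proof): periodic boundary conditions destroy
diagonal RP — Fröhlich–Israel–Lieb–Simon, J. Stat. Phys. 22 (1980) 297, §3 (Model 3.1); M. Biskup, in LNM 1970
(2009) §5.5; the statements here are theorem-level, gauge-theoretic forms of that obstruction (tribunal t2 F-R1).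
-/

open MeasureTheory Complex Finset Function
open scoped ComplexOrder ENNReal

namespace Summit.QuantumFields.GaugeBoot

open Literature.MathematicalPhysics.QuantumFieldTheory
open Literature.RepresentationTheory.CompactGroups

noncomputable section

namespace DiagRPTwo

/-! ## Assembly: the observable and the sign of `⟨(ΘF)‾ F⟩` -/

section Main

variable {L N : ℕ} [NeZero L] {G : Type*} [Group G] [TopologicalSpace G] [IsTopologicalGroup G]
  [CompactSpace G] [MeasurableSpace G] [BorelSpace G] [SecondCountableTopology G]
  (ρ : G →* Matrix (Fin N) (Fin N) ℂ)

/-- **L3(δ): diagonal reflection positivity fails on the two-dimensional even torus, at every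
non-zero coupling.** Let `L ≥ 4` be even, `G` a compact metrisable group, `ρ` a continuous
`N`-dimensional representation whose character is not constant (`Re tr ρ(g) ≠ N` for some `g`),
`β ≠ 0`, and `i ≠ j` the two directions. Then there is a bounded measurable observable `F` of the
closed diagonal half `{0 ≤ (y_i - y_j) mod L ≤ L/2}` with `⟨(ΘF)‾ F⟩_{Λ,β} < 0` (real and
negative), `Θ` the diagonal swap. Witness:
`F = (φ₀(D_{y₁}) + s φ₀(D_{y₂})) · exp(-β Σ_{0 < k < L/2} Re tr ρ(U_y))` with `y₁ = (L/2) e_i`,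
`y₂ = θ y₁ = (L/2) e_j`, `D_y = U(y,j) U(y+e_j,i)`, `φ₀ = φ - ∫φ` for the bump `φ` of
`exists_bump` and `s = -sign β`. -/
theorem exists_diagonalHalfObservable_wilsonExpectation_neg_two [T2Space G] (hL : Even L)
    (h4 : 4 ≤ L) (hρ : Continuous ρ) (hρN : ∃ g, ((ρ g).trace).re ≠ N) {β : ℝ} (hβ : β ≠ 0)
    {i j : Fin 2} (hij : i ≠ j) :
    ∃ F : GaugeConfig 2 L G → ℂ, Measurable F ∧ (∃ C : ℝ, ∀ U, ‖F U‖ ≤ C) ∧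
      IsDiagonalHalfObservable i j F ∧
      wilsonExpectation ρ β (fun U => (starRingEnd ℂ) (F (configDiagSwap i j U)) * F U) < 0 := by
  classical
  obtain ⟨φ, δ, s, hφc, hφ0, hφ1, hs, hm, hV, hsign⟩ := exists_bump ρ hρ hρN hβ
  set m : ℝ := ∫ x, φ x ∂(haarProbability G) with hm_def
  set g : G → ℝ := fun x => φ x - m with hg_def
  have hφm : Measurable φ := hφc.measurable
  have hgm : Measurable g := hφm.sub measurable_const
  have hφi : Integrable φ (haarProbability G) := Integrable.of_bound hφm.aestronglyMeasurable 1
    (ae_of_all _ fun x => by rw [Real.norm_eq_abs, abs_of_nonneg (hφ0 x)]; exact hφ1 x)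
  have hm1 : m ≤ 1 := by
    have h := integral_mono hφi (integrable_const (1 : ℝ)) hφ1
    rwa [integral_const, smul_eq_mul, probReal_univ, one_mul] at h
  have hg1 : ∀ x, |g x| ≤ 1 := fun x => by
    rw [hg_def, abs_le]
    constructor <;> linarith [hφ0 x, hφ1 x]
  have hg0 : ∫ x, g x ∂(haarProbability G) = 0 := by
    rw [hg_def, integral_sub hφi (integrable_const m), integral_const, smul_eq_mul, probReal_univ,
      one_mul, sub_self]
  -- the swap orbit `{y₁, y₂}` in the back layer
  have h10 : (1 : ZMod L) ≠ 0 := by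
    intro h0
    have := val_one_of_four_le h4
    rw [h0, ZMod.val_zero] at this
    omega
  set c : ZMod L := cc L with hc
  set y₁ : Site 2 L := Pi.single i c with hy₁
  set y₂ : Site 2 L := siteDiagSwap i j y₁ with hy₂
  have hk₁ : kd i j y₁ = c := by
    simp only [kd, hy₁, Pi.single_eq_same, Pi.single_eq_of_ne' hij, sub_zero]
  have hk₂ : kd i j y₂ = c := by rw [hy₂, kd_siteDiagSwap, hk₁, hc, neg_cc hL]
  have hθ₂ : siteDiagSwap i j y₂ = y₁ := siteDiagSwap_siteDiagSwap i j y₁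
  have hne : y₁ ≠ y₂ := by
    intro h
    have h0 : kd i j y₁ = 0 := kd_eq_zero_of_siteDiagSwap_eq y₁ (by rw [← hy₂, ← h])
    exact cc_ne_zero h4 (by rw [← hc, ← hk₁, h0])
  have hy₁c : y₁ ∈ Sc i j := by rw [mem_Sc, hk₁, hc, cc_val h4]
  have hy₂c : y₂ ∈ Sc i j := by rw [mem_Sc, hk₂, hc, cc_val h4]
  have hy₂c' : y₂ ∈ (Sc i j).erase y₁ := Finset.mem_erase.2 ⟨hne.symm, hy₂c⟩
  set Sc2 : Finset (Site 2 L) := ((Sc i j).erase y₁).erase y₂ with hSc2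
  -- the observable
  set Ft : GaugeConfig 2 L G → ℝ := fun U => g (dT i j U y₁) + s * g (dT i j U y₂) with hFt
  set Rm : GaugeConfig 2 L G → ℝ :=
    fun U => Real.exp (-(β * ∑ y ∈ Sp i j, rr ρ i j U y)) with hRm
  set h : GaugeConfig 2 L G → ℝ := fun U => Ft U * Rm U with hh
  have hsum_m : ∀ S : Finset (Site 2 L),
      Measurable fun U : GaugeConfig 2 L G => ∑ y ∈ S, rr ρ i j U y :=
    fun S => Finset.measurable_sum _ fun y _ => measurable_rr ρ hρ i j y
  have hFtm : Measurable Ft :=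
    (hgm.comp (measurable_dT i j y₁)).add ((hgm.comp (measurable_dT i j y₂)).const_mul s)
  have hRmm : Measurable Rm := ((hsum_m _).const_mul β).neg.exp
  have hhm : Measurable h := hFtm.mul hRmm
  have hs1 : |s| = 1 := by rcases hs with rfl | rfl <;> simp
  have hFtb : ∀ U, |Ft U| ≤ 2 := fun U => by
    rw [hFt]
    calc |g (dT i j U y₁) + s * g (dT i j U y₂)| ≤ |g (dT i j U y₁)| + |s * g (dT i j U y₂)| :=
          abs_add_le _ _
      _ ≤ 1 + 1 := by
          rw [abs_mul, hs1, one_mul]; exact add_le_add (hg1 _) (hg1 _)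
      _ = 2 := by norm_num
  set KR : ℝ := Real.exp (|β| * ((Sp (L := L) i j).card * N)) with hKR
  have hRmb : ∀ U, |Rm U| ≤ KR := fun U => by
    rw [hRm]
    simp only
    rw [abs_of_pos (Real.exp_pos _), hKR, Real.exp_le_exp]
    calc -(β * ∑ y ∈ Sp i j, rr ρ i j U y) ≤ |β * ∑ y ∈ Sp i j, rr ρ i j U y| := neg_le_abs _
      _ = |β| * |∑ y ∈ Sp i j, rr ρ i j U y| := abs_mul _ _
      _ ≤ |β| * ((Sp (L := L) i j).card * N) :=
          mul_le_mul_of_nonneg_left (abs_sum_rr_le ρ hρ i j _ U) (abs_nonneg β)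
  refine ⟨fun U => (h U : ℂ), Complex.measurable_ofReal.comp hhm, ⟨2 * KR, fun U => ?_⟩, ?_, ?_⟩
  · -- boundedness
    rw [Complex.norm_real, Real.norm_eq_abs, hh]
    simp only
    rw [abs_mul]
    exact mul_le_mul (hFtb U) (hRmb U) (abs_nonneg _) zero_le_two
  · -- support in the closed diagonal half
    intro U V hUV
    have hUV' : ∀ e : Edge 2 L, InHalf i j e → U e = V e := fun e he => hUV e he.1 he.2
    have hd : ∀ y : Site 2 L, kd i j y = c → dT i j U y = dT i j V y := fun y hy => by
      obtain ⟨h1, h2⟩ := inHalf_dT_links h4 hij hy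
      simp only [dT, hUV' _ h1, hUV' _ h2]
    have hr : ∀ y ∈ Sp i j, rr ρ i j U y = rr ρ i j V y := fun y hy =>
      dependsOn_blk i j y (fun c d => ((ρ (c * d⁻¹)).trace).re)
        (fun e he => hUV' e (inHalf_blk h4 hij hy he))
    show ((h U : ℝ) : ℂ) = (h V : ℂ)
    rw [hh]
    simp only [hFt, hRm]
    rw [hd y₁ hk₁, hd y₂ hk₂, Finset.sum_congr rfl hr]
  · -- the sign of `⟨(ΘF)‾ F⟩`
    have hint_eq : (fun U => (starRingEnd ℂ) ((h (configDiagSwap i j U) : ℝ) : ℂ) * (h U : ℂ)) =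
        fun U => ((h (configDiagSwap i j U) * h U : ℝ) : ℂ) := by
      funext U
      rw [Complex.conj_ofReal]
      push_cast
      ring
    rw [hint_eq, wilsonExpectation_ofReal_eq ρ hρ β, ← Complex.ofReal_zero, Complex.real_lt_real]
    obtain ⟨hZ0, hZtop⟩ := partitionFunction_ne_zero_ne_top (d := 2) (L := L) ρ hρ β
    refine mul_neg_of_pos_of_neg
      (ENNReal.toReal_pos (ENNReal.inv_ne_zero.2 hZtop) (ENNReal.inv_ne_top.2 hZ0)) ?_
    -- the factors
    set E : Site 2 L → GaugeConfig 2 L G → ℝ := fun y U => Real.exp (β * rr ρ i j U y) with hE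
    set A : GaugeConfig 2 L G → ℝ := fun U => Real.exp (β * ∑ y ∈ S0 i j, rr ρ i j U y) with hA
    set B : GaugeConfig 2 L G → ℝ := fun U => Real.exp (β * ∑ y ∈ Sc2, rr ρ i j U y) with hB
    set W : GaugeConfig 2 L G → ℝ := fun U => E y₁ U * E y₂ U *
      ((g (cT i j U y₂) + s * g (cT i j U y₁)) * (g (dT i j U y₁) + s * g (dT i j U y₂))) with hW
    set Cst : ℝ := Real.exp (-(β * (N * Fintype.card (Plaquette 2 L)))) with hCst
    -- pointwise factorisation of the integrand
    have hpt : ∀ U : GaugeConfig 2 L G,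
        Real.exp (-β * wilsonAction ρ U) * (h (configDiagSwap i j U) * h U) =
          Cst * (A U * (B U * W U)) := by
      intro U
      have hS := wilsonAction_eq_sum_rr ρ hρ hij U
      have hsp := sum_split h4 i j (fun y => rr ρ i j U y)
      have hSc : ∑ y ∈ Sc i j, rr ρ i j U y =
          ∑ y ∈ Sc2, rr ρ i j U y + rr ρ i j U y₂ + rr ρ i j U y₁ := by
        rw [hSc2, Finset.sum_erase_add _ _ hy₂c', Finset.sum_erase_add _ _ hy₁c]
      have hFtΘ : Ft (configDiagSwap i j U) = g (cT i j U y₂) + s * g (cT i j U y₁) := by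
        rw [hFt]
        simp only [dT_configDiagSwap]
        rw [← hy₂, hθ₂]
      have hRmΘ : Rm (configDiagSwap i j U) =
          Real.exp (-(β * ∑ y ∈ Sm i j, rr ρ i j U y)) := by
        rw [hRm]
        simp only [rr_configDiagSwap ρ hρ]
        rw [sum_Sp_swap hL i j (fun y => rr ρ i j U y)]
      have e1 : ∀ X Y Z P Q : ℝ, Real.exp X * ((P * Real.exp Y) * (Q * Real.exp Z)) =
          Real.exp (X + Y + Z) * (P * Q) := by
        intros; rw [Real.exp_add, Real.exp_add]; ring
      have e2 : ∀ X₀ X₁ X₂ X₃ X₄ P : ℝ, Real.exp X₀ * (Real.exp X₁ * (Real.exp X₂ *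
          (Real.exp X₃ * Real.exp X₄ * P))) = Real.exp (X₀ + X₁ + X₂ + X₃ + X₄) * P := by
        intros; simp only [Real.exp_add]; ring
      rw [hh]
      simp only
      rw [hFtΘ, hRmΘ, hFt, hRm, hS, hsp, hSc]
      simp only
      rw [e1, hCst, hA, hB, hW, hE]
      simp only
      rw [e2]
      congr 1
      exact congrArg Real.exp (by ring)
    -- independence structure
    have hdisj1 : Disjoint ((S0 (L := L) i j).biUnion (blk i j)) ((Sc i j).biUnion (blk i j)) := by
      rw [Finset.disjoint_biUnion_left]
      intro y hy
      rw [Finset.disjoint_biUnion_right]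
      intro y' hy'
      rw [mem_S0, ← kd_eq_zero_iff] at hy
      rw [mem_Sc, ← kd_eq_cc_iff h4] at hy'
      refine disjoint_blk hij ?_ ?_ ?_
      · intro hyy; rw [hyy, hy'] at hy; exact cc_ne_zero h4 hy
      · rw [hy, hy', zero_add]; exact cc_ne_one h4
      · rw [hy, hy']; intro h0; exact cc_ne_neg_one h4 (eq_neg_of_add_eq_zero_left h0.symm)
    have hSc2sub : Sc2 ⊆ Sc i j := (Finset.erase_subset _ _).trans (Finset.erase_subset _ _)
    have hdisj2 : Disjoint (Sc2.biUnion (blk i j)) (blk i j y₁ ∪ blk i j y₂) := by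
      rw [Finset.disjoint_biUnion_left]
      intro y hy
      have hy' := hy
      rw [hSc2, Finset.mem_erase, Finset.mem_erase, mem_Sc, ← kd_eq_cc_iff h4] at hy'
      obtain ⟨hyne₂, hyne₁, hyc⟩ := hy'
      have hcc : c ≠ c + 1 := fun h0 => h10 (by
        have := congrArg (fun z => z - c) h0; simpa using this.symm)
      rw [Finset.disjoint_union_right]
      exact ⟨disjoint_blk hij hyne₁ (by rw [hk₁, hyc, ← hc]; exact hcc)
          (by rw [hk₁, hyc, ← hc]; exact hcc),
        disjoint_blk hij hyne₂ (by rw [hk₂, hyc, ← hc]; exact hcc)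
          (by rw [hk₂, hyc, ← hc]; exact hcc)⟩
    -- dependence of the factors on their blocks
    have hAdep : DependsOn A ((S0 (L := L) i j).biUnion (blk i j) : Set (Edge 2 L)) :=
      fun U V hUV => congrArg (fun t => Real.exp (β * t)) (dependsOn_sum_rr ρ i j _ hUV)
    have hBdep : DependsOn B (Sc2.biUnion (blk i j) : Set (Edge 2 L)) :=
      fun U V hUV => congrArg (fun t => Real.exp (β * t)) (dependsOn_sum_rr ρ i j _ hUV)
    have hWdep : DependsOn W ((blk i j y₁ ∪ blk i j y₂ : Finset (Edge 2 L)) : Set (Edge 2 L)) := by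
      intro U V hUV
      have e₁ := dependsOn_blk i j y₁ Prod.mk
        (fun e he => hUV e (Finset.mem_union_left _ he))
      have e₂ := dependsOn_blk i j y₂ Prod.mk
        (fun e he => hUV e (Finset.mem_union_right _ he))
      simp only [Prod.mk.injEq] at e₁ e₂
      rw [hW, hE]
      simp only [rr, e₁.1, e₁.2, e₂.1, e₂.2]
    have hsub1 : ((Sc2.biUnion (blk i j) : Finset (Edge 2 L)) : Set (Edge 2 L)) ⊆
        ((Sc (L := L) i j).biUnion (blk i j) : Finset (Edge 2 L)) :=
      Finset.coe_subset.2 (Finset.biUnion_subset_biUnion_of_subset_left _ hSc2sub)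
    have hsub2 : ((blk i j y₁ ∪ blk i j y₂ : Finset (Edge 2 L)) : Set (Edge 2 L)) ⊆
        ((Sc (L := L) i j).biUnion (blk i j) : Finset (Edge 2 L)) :=
      Finset.coe_subset.2 (Finset.union_subset (Finset.subset_biUnion_of_mem (blk i j) hy₁c)
        (Finset.subset_biUnion_of_mem (blk i j) hy₂c))
    have hBWdep : DependsOn (fun U => B U * W U) ((Sc (L := L) i j).biUnion (blk i j) : Set (Edge 2
        L)) :=
      fun U V hUV => by
        show B U * W U = B V * W V
        rw [hBdep.mono hsub1 hUV, hWdep.mono hsub2 hUV]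
    -- measurability of the factors
    have hEm : ∀ y, Measurable (E y) := fun y => ((measurable_rr ρ hρ i j y).const_mul β).exp
    have hAm : Measurable A := ((hsum_m _).const_mul β).exp
    have hBm : Measurable B := ((hsum_m _).const_mul β).exp
    have hWm : Measurable W :=
      ((hEm y₁).mul (hEm y₂)).mul
        (((hgm.comp (measurable_cT i j y₂)).add ((hgm.comp (measurable_cT i j y₁)).const_mul s)).mul
          ((hgm.comp (measurable_dT i j y₁)).add ((hgm.comp (measurable_dT i j y₂)).const_mul s)))
    -- the integral factorises
    have hI : ∫ U, Real.exp (-β * wilsonAction ρ U) * (h (configDiagSwap i j U) * h U)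
        ∂(linkMeasure L G) =
        Cst * ((∫ U, A U ∂(linkMeasure L G)) * ((∫ U, B U ∂(linkMeasure L G)) * ∫ U, W U
            ∂(linkMeasure L G))) := by
      rw [show (fun U => Real.exp (-β * wilsonAction ρ U) * (h (configDiagSwap i j U) * h U)) =
          fun U => Cst * (A U * (B U * W U)) from funext hpt, integral_const_mul,
        integral_mul_eq_of_dependsOn_real _ _ hdisj1 (f := A) (g := fun U => B U * W U) hAm
          (hBm.mul hWm) hAdep hBWdep,
        integral_mul_eq_of_dependsOn_real _ _ hdisj2 (f := B) (g := W) hBm hWm hBdep hWdep]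
    -- the orbit integral
    have hWI : ∫ U, W U ∂(linkMeasure L G) = s * (∫ x, κ ρ β x ∂(haarProbability G)) *
        (∫ U, κ ρ β (U (y₁, i) * (U (y₁, j))⁻¹) * (g (U (y₁, i)) * g (U (y₁, j))) ∂(linkMeasure L
            G) +
          ∫ U, κ ρ β (U (y₂, i) * (U (y₂, j))⁻¹) * (g (U (y₂, i)) * g (U (y₂, j))) ∂(linkMeasure L
              G)) :=
      integral_orbit ρ h4 hij hρ β hne (hk₁.trans hk₂.symm) hgm hg1 hg0 s
    -- signs
    have hne₁ : ((y₁, i) : Edge 2 L) ≠ (y₁, j) := fun h0 => hij (Prod.ext_iff.1 h0).2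
    have hne₂ : ((y₂, i) : Edge 2 L) ≠ (y₂, j) := fun h0 => hij (Prod.ext_iff.1 h0).2
    have hQ₁ := sign_Q ρ hρ β hne₁ hφc hφ0 hφ1 hs hm hV hsign
    have hQ₂ := sign_Q ρ hρ β hne₂ hφc hφ0 hφ1 hs hm hV hsign
    have hc₀ : 0 < ∫ x, κ ρ β x ∂(haarProbability G) :=
      integral_pos_of_continuous (continuous_κ ρ hρ β) (fun x => (κ_pos ρ β x).le)
        (B := Real.exp (|β| * N)) (fun x => (le_abs_self _).trans (abs_κ_le ρ hρ β x))
        (x₀ := 1) (κ_pos ρ β 1)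
    have hIA : 0 < ∫ U, A U ∂(linkMeasure L G) :=
      integral_exp_pos ((hsum_m _).const_mul β) (B := |β| * ((S0 (L := L) i j).card * N)) fun U =>
          by
        rw [abs_mul]
        exact mul_le_mul_of_nonneg_left (abs_sum_rr_le ρ hρ i j _ U) (abs_nonneg β)
    have hIB : 0 < ∫ U, B U ∂(linkMeasure L G) :=
      integral_exp_pos ((hsum_m _).const_mul β) (B := |β| * (Sc2.card * N)) fun U => by
        rw [abs_mul]
        exact mul_le_mul_of_nonneg_left (abs_sum_rr_le ρ hρ i j _ U) (abs_nonneg β)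
    have hIW : ∫ U, W U ∂(linkMeasure L G) < 0 := by
      rw [hWI]
      have : s * (∫ x, κ ρ β x ∂(haarProbability G)) *
          (∫ U, κ ρ β (U (y₁, i) * (U (y₁, j))⁻¹) * (g (U (y₁, i)) * g (U (y₁, j))) ∂(linkMeasure L
              G) +
            ∫ U, κ ρ β (U (y₂, i) * (U (y₂, j))⁻¹) * (g (U (y₂, i)) * g (U (y₂, j))) ∂(linkMeasure
                L G)) =
          (∫ x, κ ρ β x ∂(haarProbability G)) *
            (s * ∫ U, κ ρ β (U (y₁, i) * (U (y₁, j))⁻¹) * (g (U (y₁, i)) * g (U (y₁, j)))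
                ∂(linkMeasure L G) +
              s * ∫ U, κ ρ β (U (y₂, i) * (U (y₂, j))⁻¹) * (g (U (y₂, i)) * g (U (y₂, j)))
                  ∂(linkMeasure L G)) := by
        ring
      rw [this]
      exact mul_neg_of_pos_of_neg hc₀ (by linarith)
    rw [hI]
    exact mul_neg_of_pos_of_neg (Real.exp_pos _) (mul_neg_of_pos_of_neg hIA
      (mul_neg_of_pos_of_neg hIB hIW))

/-- **L3(δ), corollary: `¬ DiagonalReflectionPositive` on the two-dimensional even torus**
`(ℤ/L)²`, `L ≥ 4`, for every `β ≠ 0`, every compact metrisable group and every continuous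
representation with non-constant character. Together with `not_diagonalReflectionPositive`
(`d ≥ 3`, every `β`): no diagonal-RP (`R₂`-type) block is available to a TORUS certificate in any
dimension. -/
theorem not_diagonalReflectionPositive_two [T2Space G] (hL : Even L) (h4 : 4 ≤ L)
    (hρ : Continuous ρ) (hρN : ∃ g, ((ρ g).trace).re ≠ N) {β : ℝ} (hβ : β ≠ 0) {i j : Fin 2}
    (hij : i ≠ j) : ¬ DiagonalReflectionPositive (d := 2) (L := L) ρ β i j := by
  intro hRP
  obtain ⟨F, hF, hFb, hFH, hneg⟩ :=
    exists_diagonalHalfObservable_wilsonExpectation_neg_two ρ hL h4 hρ hρN hβ hij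
  exact lt_irrefl _ (lt_of_le_of_lt (hRP F hF hFb hFH) hneg)

end Main

end DiagRPTwo

end

end Summit.QuantumFields.GaugeBoot
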